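/-
Copyright (c) 2026 the pub-hodgecm-mathlib formalisation cell (harness21).  Prover seat hodgecm-mathlib-F0P2-p06 (g13): road «S3-ram» (LEAD F0P3a-plan (g12); architect
A-p16 (g31); owner F0P3a-p06 (g15)), organ A′ (ii) (B4) G3‴ «THE CLASS SPLIT ON THE CONIC»; 2026-09-02.
-/
import Literature.GroupTheory.SpecificGroups.OrthogonalThreeNullIsotropicParamsCount   -- ★ p847343 (this seat, g12): G3″ params currency `x̄_p`, transport, `ν = 2 ∕ 1 ∕ q+1`
import Mathlib.NumberTheory.LegendreSymbol.QuadraticChar.Basic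
import HarnessLib

/-!
# Isotropic points of the ternary conic CUT BY A SQUARE CLASS of `ᵗx (J₀Y) x`: for a regular nilpotent `J₀`-symmetric `Y` every class predicate is met by as many points
# as it has values — so each square class `(q − 1)∕2` times —, for a rank-one `Y` by `q` points or none (Wilson 2009 §3.7; Bruhat–Tits 1972 §10; Ireland–Rosen Ch. 8)

Topic `GroupTheory/SpecificGroups`; namespace `Literature.GroupTheory.SpecificGroups`.  THEOREMS ONLY (no definition, no named fact, no instance, no notation, no `sorry`);
kernel lane `--supports stmt-HodgeConjecture-24833`.  Cell `pub/hodgecm-mathlib` (crux H413), road «S3-ram» (Literature seeding, count-neutral), organ A′ (ii) (B4) of the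
P-1-ram skeleton (architect A-p16 (g31)), part **G3‴** — the residual input of the tree-induction engine's rows `hO` and `hP`
(★ `Rogawski1990/DepthZeroKappaTransferTypeOneRamifiedTreeInduction`: at an odd-depth rank-two vertex the non-null lines split `q.choose 2 + q.choose 2` by class after the `q`
lifts; at a rank-one vertex all `q²` grandchildren carry ONE class).  Currency of ★ G3″ `OrthogonalThreeNullIsotropicParamsCount` (this seat, g12): the `q + 1` points of the conic
`ᵗxJ₀x = 2x₁x₃ + x₂² = 0` are the NORMALISED PARAMETERS `p ∈ {∞} ⊔ {(a,b) : 2b + a² = 0}`, `x̄_∞ = e₃`, `x̄_(a,b) = (1,a,b)`, and `Q_Y(x̄) := ᵗx̄ (J₀Y) x̄`; ★ G3″ counted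
`#{p : Q_Y(x̄_p) = 0} = 2, 1, q+1`.  THIS FILE counts `#{p : P(Q_Y(x̄_p))}` for an ARBITRARY predicate `P` invariant under non-zero squares (`P(c²t) ↔ P(t)`, `c ≠ 0` — a union of
square classes, the only kind of condition that descends from vectors to points) NOT containing `0`:
* (§1) TRANSPORT `O(J₀)`: `#{x ≠ 0 iso : P(Q_{gYg⁻¹} x)} = #{x ≠ 0 iso : P(Q_Y x)}`; (§2) VECTORS = UNITS × PARAMETERS: `(q−1)·#{p : P(Q_M x̄_p)} = #{x ≠ 0 iso : P(Q_M x)}` (any `M`);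
* (§3) AT THE NORMAL FORMS: `Q_R(x) = 2x₁x₂` on `2x₁x₃ + x₂² = 0` sweeps EVERY value once along each `x₁ ≠ 0` (and is `0` on the line `x₁ = 0`), so `#{x ≠ 0 iso : P(Q_R x)} =
  (q−1)·#{t : P t}`; `Q_{N(c)}(x) = c·x₁²` is in the class of `c` off `x₁ = 0`, so `#{x ≠ 0 iso : P(Q_{N(c)} x)} = (q−1)·q` if `P c`, `0` if not;
* (§4) **`#{p : P(Q_Y(x̄_p))} = #{t ∈ K : P t}`** for `Y³ = 0 ≠ Y²` (`natCard_params_eq_natCard_of_sq_ne_zero`), **`= q` or `= 0` according as `P c`** for `gYg⁻¹ = N(c)`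
  (`natCard_params_eq_card_of_conj_cornerSymmetric`, `natCard_params_eq_zero_of_conj_cornerSymmetric`), and the class of `Q_Y` is CONSTANT off the null point in rank one
  (`pred_form_iff_of_conj_cornerSymmetric`: `P(Q_Y x) ↔ P(c)` whenever `Q_Y x ≠ 0`);
* (§5) THE CLASS SPLIT: `2·#{t : χ(c₀t) = σ} = q − 1` (`two_mul_natCard_quadraticChar_mul_eq`), hence for `Y³ = 0 ≠ Y²`, `c₀ ≠ 0`, `σ = ±1`:
  **`2·#{p : χ(c₀·Q_Y(x̄_p)) = σ} = q − 1`** (`two_mul_natCard_params_quadraticChar_eq_of_sq_ne_zero`), **`q·#{p : χ(c₀·Q_Y(x̄_p)) = σ} = q.choose 2`** (the engine's `hO`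
  token, `natCard_mul_natCard_params_quadraticChar_eq_choose_two`), the token-class form **`2·#{p : ∃ a ≠ 0, Q_Y(x̄_p) = s·a²} = q − 1`**
  (`two_mul_natCard_params_sqClass_eq_of_sq_ne_zero`), and for `gYg⁻¹ = N(c)`: `#{p : χ(c₀·Q_Y(x̄_p)) = σ} = q` if `χ(c₀c) = σ` else `0` (`natCard_params_quadraticChar_eq_ite_of_conj_cornerSymmetric`).

HONEST LABEL: HC_CM is proved only modulo the 2 remaining named inputs (hLiu418 24832, h413 24833) until rung 0 closes; elementary finite-field algebra, count-neutral
Literature seeding; nothing about the transfer is asserted.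

## References
* [Wilson2009] R. A. Wilson, *The Finite Simple Groups*, GTM 251 (2009): §3.7.1 p. 70 (the `q + 1` points of a conic; isotropic vectors of ternary forms).
* [BruhatTits1972] F. Bruhat, J. Tits, *Groupes réductifs sur un corps local* I, Publ. Math. IHÉS 41 (1972): §10 (the residual building at a vertex of the ramified
  `U(3)` tree is this conic).
* [IrelandRosen1990] K. Ireland, M. Rosen, *A Classical Introduction to Modern Number Theory*, GTM 84: Ch. 8 §1 (the quadratic character; `(q−1)∕2` residues and non-residues).
* [CollingwoodMcGovern1993] D. Collingwood, W. McGovern, *Nilpotent Orbits in Semisimple Lie Algebras* (1993): §9.3 (normal forms `N(c)`, `R`).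
-/

set_option autoImplicit false

open Matrix Literature.NumberTheory.Automorphic Literature.NumberTheory.Automorphic.HermitianLattice Literature.NumberTheory.Automorphic.UnitaryGroup

namespace Literature.GroupTheory.SpecificGroups

variable {K : Type*} [Field K]

/-! ## §1 Transport: predicate-cut isotropic counts are `O(J₀)`-conjugation invariants -/

/-- **TRANSPORT**: for `g ∈ O(J₀)` and ANY predicate `P` on values, the non-zero isotropic vectors `x` with `P(ᵗx(J₀·gYg⁻¹)x)` are the `g`-translates of those with
`P(ᵗx(J₀Y)x)` (★ (C3) `dotProduct_form_conj_of_mem`, `dotProduct_antidiagonal_mulVec_of_mem`), so the two counts agree. [cite: Wilson2009, §3.7.1 p. 70] -/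
theorem ncard_isotropic_form_conj_eq_of_pred {g : GL (Fin 3) K} (hg : g ∈ unitaryGroupOfForm (RingHom.id K) ((StdForm.antidiagonal 3).over K))
    (Y : Matrix (Fin 3) (Fin 3) K) (P : K → Prop) :
    {x : Fin 3 → K | x ≠ 0 ∧ x ⬝ᵥ (((StdForm.antidiagonal 3).over K) *ᵥ x) = 0 ∧
        P (x ⬝ᵥ (((StdForm.antidiagonal 3).over K * ((g : Matrix (Fin 3) (Fin 3) K) * Y * ((g⁻¹ : GL (Fin 3) K) : Matrix (Fin 3) (Fin 3) K))) *ᵥ x))}.ncard =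
      {x : Fin 3 → K | x ≠ 0 ∧ x ⬝ᵥ (((StdForm.antidiagonal 3).over K) *ᵥ x) = 0 ∧ P (x ⬝ᵥ (((StdForm.antidiagonal 3).over K * Y) *ᵥ x))}.ncard := by
  have hinv : ∀ x : Fin 3 → K, ((g⁻¹ : GL (Fin 3) K) : Matrix (Fin 3) (Fin 3) K) *ᵥ ((g : Matrix (Fin 3) (Fin 3) K) *ᵥ x) = x := fun x => by
    rw [Matrix.mulVec_mulVec, ← Units.val_mul, inv_mul_cancel, Units.val_one, Matrix.one_mulVec]
  have hinv' : ∀ x : Fin 3 → K, (g : Matrix (Fin 3) (Fin 3) K) *ᵥ (((g⁻¹ : GL (Fin 3) K) : Matrix (Fin 3) (Fin 3) K) *ᵥ x) = x := fun x => by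
    rw [Matrix.mulVec_mulVec, ← Units.val_mul, mul_inv_cancel, Units.val_one, Matrix.one_mulVec]
  have himage : {x : Fin 3 → K | x ≠ 0 ∧ x ⬝ᵥ (((StdForm.antidiagonal 3).over K) *ᵥ x) = 0 ∧
        P (x ⬝ᵥ (((StdForm.antidiagonal 3).over K * ((g : Matrix (Fin 3) (Fin 3) K) * Y * ((g⁻¹ : GL (Fin 3) K) : Matrix (Fin 3) (Fin 3) K))) *ᵥ x))} =
      (fun x => (g : Matrix (Fin 3) (Fin 3) K) *ᵥ x) ''
        {x : Fin 3 → K | x ≠ 0 ∧ x ⬝ᵥ (((StdForm.antidiagonal 3).over K) *ᵥ x) = 0 ∧ P (x ⬝ᵥ (((StdForm.antidiagonal 3).over K * Y) *ᵥ x))} := by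
    ext x
    simp only [Set.mem_setOf_eq, Set.mem_image]
    constructor
    · rintro ⟨hx0, hiso, hP⟩
      refine ⟨((g⁻¹ : GL (Fin 3) K) : Matrix (Fin 3) (Fin 3) K) *ᵥ x, ⟨fun h0 => hx0 ?_, ?_, ?_⟩, hinv' x⟩
      · rw [← hinv' x, h0, Matrix.mulVec_zero]
      · rw [← dotProduct_antidiagonal_mulVec_of_mem hg, hinv' x]; exact hiso
      · rw [← dotProduct_form_conj_of_mem hg Y x]; exact hP
    · rintro ⟨x', ⟨hx'0, hiso', hP'⟩, rfl⟩
      refine ⟨fun h0 => hx'0 ?_, ?_, ?_⟩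
      · rw [← hinv x', h0, Matrix.mulVec_zero]
      · rw [dotProduct_antidiagonal_mulVec_of_mem hg]; exact hiso'
      · rw [dotProduct_form_conj_of_mem hg Y, hinv x']; exact hP'
  rw [himage, Set.ncard_image_of_injective _ (fun x x' (h : (g : Matrix (Fin 3) (Fin 3) K) *ᵥ x = (g : Matrix (Fin 3) (Fin 3) K) *ᵥ x') => by
    rw [← hinv x, ← hinv x', h])]

/-! ## §2 Non-zero isotropic vectors cut by a square-class condition = units × normalised parameters cut by it -/

/-- **`(q − 1)·#{p : P(ᵗx̄_p(J₀M)x̄_p)} = #{x ≠ 0 : ᵗxJ₀x = 0 ∧ P(ᵗx(J₀M)x)}`** for ANY matrix `M` and any predicate `P` INVARIANT UNDER NON-ZERO SQUARES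
(`P(c²t) ↔ P(t)`): units `×` parameters `≃` non-zero isotropic vectors via `(c, p) ↦ c·x̄_p` (★ G3″ §3), and `ᵗ(cx)A(cx) = c²·ᵗxAx`. [cite: Wilson2009, §3.7.1 p. 70]
[cite: BruhatTits1972, §10] -/
theorem card_sub_one_mul_natCard_params_eq_ncard [Finite K] (M : Matrix (Fin 3) (Fin 3) K) (P : K → Prop)
    (hP : ∀ c t : K, c ≠ 0 → (P (c * c * t) ↔ P t)) :
    (Nat.card K - 1) * Nat.card {p : Option {p : K × K // p.2 + (RingHom.id K) p.2 + p.1 * (RingHom.id K) p.1 = 0} //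
        P ((p.elim (Pi.single 2 1) fun q => ![(1 : K), q.1.1, q.1.2]) ⬝ᵥ ((((StdForm.antidiagonal 3).over K) * M) *ᵥ (p.elim (Pi.single 2 1) fun q => ![(1 : K), q.1.1, q.1.2])))} =
      {x : Fin 3 → K | x ≠ 0 ∧ x ⬝ᵥ (((StdForm.antidiagonal 3).over K) *ᵥ x) = 0 ∧ P (x ⬝ᵥ ((((StdForm.antidiagonal 3).over K) * M) *ᵥ x))}.ncard := by
  classical
  haveI := Fintype.ofFinite K
  rw [← Nat.card_coe_set_eq, Nat.card_eq_fintype_card (α := K), ← Fintype.card_units, ← Nat.card_eq_fintype_card, ← Nat.card_prod]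
  refine Nat.card_congr (Equiv.ofBijective
    (fun cp : Kˣ × {p : Option {p : K × K // p.2 + (RingHom.id K) p.2 + p.1 * (RingHom.id K) p.1 = 0} //
        P ((p.elim (Pi.single 2 1) fun q => ![(1 : K), q.1.1, q.1.2]) ⬝ᵥ ((((StdForm.antidiagonal 3).over K) * M) *ᵥ (p.elim (Pi.single 2 1) fun q => ![(1 : K), q.1.1, q.1.2])))} =>
      (⟨(cp.1 : K) • (cp.2.1.elim (Pi.single 2 1) fun q => ![(1 : K), q.1.1, q.1.2]),
        ⟨smul_ne_zero (Units.ne_zero cp.1) (normalParam_ne_zero cp.2.1),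
          by rw [dotProduct_smul_mulVec_smul, normalParam_isotropic, mul_zero],
          by rw [dotProduct_smul_mulVec_smul]; exact (hP _ _ (Units.ne_zero cp.1)).2 cp.2.2⟩⟩ :
        {x : Fin 3 → K | x ≠ 0 ∧ x ⬝ᵥ (((StdForm.antidiagonal 3).over K) *ᵥ x) = 0 ∧ P (x ⬝ᵥ ((((StdForm.antidiagonal 3).over K) * M) *ᵥ x))})) ⟨?_, ?_⟩)
  · rintro ⟨c, p⟩ ⟨c', p'⟩ h
    have h' := congrArg Subtype.val h
    obtain ⟨hc, hp⟩ := eq_and_eq_of_smul_normalParam_eq (Units.ne_zero c) (Units.ne_zero c') h'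
    exact Prod.ext (Units.ext hc) (Subtype.ext hp)
  · rintro ⟨x, hx0, hiso, hPx⟩
    obtain ⟨c, hc, p, rfl⟩ := exists_smul_normalParam_eq_of_isotropic hx0 hiso
    have hp : P ((p.elim (Pi.single 2 1) fun q => ![(1 : K), q.1.1, q.1.2]) ⬝ᵥ ((((StdForm.antidiagonal 3).over K) * M) *ᵥ (p.elim (Pi.single 2 1) fun q => ![(1 : K), q.1.1, q.1.2]))) := by
      rw [dotProduct_smul_mulVec_smul] at hPx
      exact (hP _ _ hc).1 hPx
    exact ⟨(Units.mk0 c hc, ⟨p, hp⟩), Subtype.ext (by simp)⟩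

/-! ## §3 The cut counts at the normal forms `R` and `N(c)` (vector currency) -/

section NormalForms

variable [Finite K]

/-- **AT `R`: `#{x ≠ 0 : ᵗxJ₀x = 0 ∧ P(ᵗx(J₀R)x)} = (q − 1)·#{t : P t}`** for any `P` with `¬P 0`: on the conic `2x₁x₃ + x₂² = 0` the form `Q_R = 2x₁x₂` vanishes on the line
`x₁ = 0` and, for each `x₁ ≠ 0`, is swept bijectively by `x₂` (`x₃ = −x₂²∕(2x₁)` being determined) — the bijection `(x₁, t) ↦ (x₁, t∕(2x₁), −t²∕(8x₁³))`.
[cite: Wilson2009, §3.7.1 p. 70] [cite: CollingwoodMcGovern1993, §9.3] -/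
theorem ncard_isotropic_regularSymmetric_form_pred (h2 : (2 : K) ≠ 0) (P : K → Prop) (hP0 : ¬ P 0) :
    {x : Fin 3 → K | x ≠ 0 ∧ x ⬝ᵥ (((StdForm.antidiagonal 3).over K) *ᵥ x) = 0 ∧ P (x ⬝ᵥ (((StdForm.antidiagonal 3).over K * !![0, 0, 0; 1, 0, 0; 0, 1, 0]) *ᵥ x))}.ncard =
      (Nat.card K - 1) * Nat.card {t : K // P t} := by
  classical
  haveI := Fintype.ofFinite K
  rw [← Nat.card_coe_set_eq, Nat.card_eq_fintype_card (α := K), ← Fintype.card_units, ← Nat.card_eq_fintype_card, ← Nat.card_prod]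
  symm
  -- the parametrisation `(u, t) ↦ (u, t∕(2u), −(t∕(2u))²∕(2u))`
  have hmem : ∀ (u : Kˣ) (t : K), P t →
      (![(u : K), t / (2 * u), -((t / (2 * u)) * (t / (2 * u))) / (2 * u)] : Fin 3 → K) ∈
        {x : Fin 3 → K | x ≠ 0 ∧ x ⬝ᵥ (((StdForm.antidiagonal 3).over K) *ᵥ x) = 0 ∧ P (x ⬝ᵥ (((StdForm.antidiagonal 3).over K * !![0, 0, 0; 1, 0, 0; 0, 1, 0]) *ᵥ x))} := by
    intro u t ht
    have hu : (u : K) ≠ 0 := Units.ne_zero u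
    have h2u : (2 : K) * u ≠ 0 := mul_ne_zero h2 hu
    refine ⟨fun h0 => hu ?_, ?_, ?_⟩
    · have h00 := congrFun h0 0
      simp only [Matrix.cons_val_zero, Pi.zero_apply] at h00
      exact h00
    · rw [dotProduct_antidiagonal_three_mulVec]
      simp only [Matrix.cons_val_zero, Matrix.cons_val_one, Matrix.cons_val_two, Matrix.head_cons, Matrix.tail_cons]
      field_simp
      ring
    · rw [dotProduct_regularSymmetric_form]
      simp only [Matrix.cons_val_zero, Matrix.cons_val_one]
      rw [show (2 : K) * ((u : K) * (t / (2 * u))) = t by field_simp]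
      exact ht
  refine Nat.card_congr (Equiv.ofBijective (fun ut : Kˣ × {t : K // P t} =>
    (⟨![(ut.1 : K), ut.2.1 / (2 * ut.1), -((ut.2.1 / (2 * ut.1)) * (ut.2.1 / (2 * ut.1))) / (2 * ut.1)], hmem ut.1 ut.2.1 ut.2.2⟩ :
      {x : Fin 3 → K | x ≠ 0 ∧ x ⬝ᵥ (((StdForm.antidiagonal 3).over K) *ᵥ x) = 0 ∧ P (x ⬝ᵥ (((StdForm.antidiagonal 3).over K * !![0, 0, 0; 1, 0, 0; 0, 1, 0]) *ᵥ x))})) ⟨?_, ?_⟩)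
  · rintro ⟨u, t, ht⟩ ⟨u', t', ht'⟩ h
    have h' := congrArg Subtype.val h
    have h0 := congrFun h' 0
    have h1 := congrFun h' 1
    simp only [Matrix.cons_val_zero, Matrix.cons_val_one] at h0 h1
    have hu : u = u' := Units.ext h0
    subst hu
    have h2u : (2 : K) * u ≠ 0 := mul_ne_zero h2 (Units.ne_zero u)
    have htt : t = t' := by
      have := congrArg (fun s => s * (2 * (u : K))) h1
      simpa [div_mul_cancel₀ _ h2u] using this
    subst htt
    rfl
  · rintro ⟨x, hx0, hiso, hPx⟩
    rw [dotProduct_antidiagonal_three_mulVec] at hiso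
    rw [dotProduct_regularSymmetric_form] at hPx
    have hx00 : x 0 ≠ 0 := by
      intro h0
      rw [h0, zero_mul, mul_zero] at hPx
      exact hP0 hPx
    have h2x : (2 : K) * x 0 ≠ 0 := mul_ne_zero h2 hx00
    refine ⟨(Units.mk0 (x 0) hx00, ⟨2 * (x 0 * x 1), hPx⟩), Subtype.ext ?_⟩
    funext i
    fin_cases i
    · simp
    · simp only [Units.val_mk0, Fin.mk_one, Matrix.cons_val_one, Matrix.cons_val_zero]
      field_simp
    · simp only [Units.val_mk0, Fin.reduceFinMk, Matrix.cons_val_two, Matrix.tail_cons, Matrix.head_cons]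
      field_simp
      linear_combination (-1 : K) * hiso

/-- **AT `N(c)`, CLASS MET: `#{x ≠ 0 : ᵗxJ₀x = 0 ∧ P(ᵗx(J₀N(c))x)} = (q − 1)·q`** when `P c` (`P` square-class invariant with `¬P 0` — so `c ≠ 0` —, `2 ≠ 0`): `Q_{N(c)}(x) = c·x₁²` lies in the
class of `c` exactly off the line `x₁ = 0`, and `{x₁ ≠ 0} ∩ conic ≃ K^× × K` by `(x₁, x₂) ↦ (x₁, x₂, −x₂²∕(2x₁))`. [cite: Wilson2009, §3.7.1 p. 70] [cite: CollingwoodMcGovern1993, §9.3] -/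
theorem ncard_isotropic_cornerSymmetric_form_pred_of_pos (h2 : (2 : K) ≠ 0) (c : K) (P : K → Prop)
    (hP : ∀ a t : K, a ≠ 0 → (P (a * a * t) ↔ P t)) (hP0 : ¬ P 0) (hPc : P c) :
    {x : Fin 3 → K | x ≠ 0 ∧ x ⬝ᵥ (((StdForm.antidiagonal 3).over K) *ᵥ x) = 0 ∧ P (x ⬝ᵥ (((StdForm.antidiagonal 3).over K * !![0, 0, 0; 0, 0, 0; c, 0, 0]) *ᵥ x))}.ncard =
      (Nat.card K - 1) * Nat.card K := by
  classical
  haveI := Fintype.ofFinite K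
  rw [← Nat.card_coe_set_eq, Nat.card_eq_fintype_card (α := K), ← Fintype.card_units, ← Nat.card_eq_fintype_card (α := Kˣ),
    ← Nat.card_eq_fintype_card (α := K), ← Nat.card_prod]
  symm
  have hmem : ∀ (u : Kˣ) (t : K),
      (![(u : K), t, -(t * t) / (2 * u)] : Fin 3 → K) ∈
        {x : Fin 3 → K | x ≠ 0 ∧ x ⬝ᵥ (((StdForm.antidiagonal 3).over K) *ᵥ x) = 0 ∧ P (x ⬝ᵥ (((StdForm.antidiagonal 3).over K * !![0, 0, 0; 0, 0, 0; c, 0, 0]) *ᵥ x))} := by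
    intro u t
    have hu : (u : K) ≠ 0 := Units.ne_zero u
    have h2u : (2 : K) * u ≠ 0 := mul_ne_zero h2 hu
    refine ⟨fun h0 => hu ?_, ?_, ?_⟩
    · have h00 := congrFun h0 0
      simp only [Matrix.cons_val_zero, Pi.zero_apply] at h00
      exact h00
    · rw [dotProduct_antidiagonal_three_mulVec]
      simp only [Matrix.cons_val_zero, Matrix.cons_val_one, Matrix.cons_val_two, Matrix.head_cons, Matrix.tail_cons]
      field_simp
      ring
    · rw [dotProduct_cornerSymmetric_form]
      simp only [Matrix.cons_val_zero]
      rw [show c * (u : K) ^ 2 = (u : K) * u * c by ring]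
      exact (hP _ _ hu).2 hPc
  refine Nat.card_congr (Equiv.ofBijective (fun ut : Kˣ × K =>
    (⟨![(ut.1 : K), ut.2, -(ut.2 * ut.2) / (2 * ut.1)], hmem ut.1 ut.2⟩ :
      {x : Fin 3 → K | x ≠ 0 ∧ x ⬝ᵥ (((StdForm.antidiagonal 3).over K) *ᵥ x) = 0 ∧ P (x ⬝ᵥ (((StdForm.antidiagonal 3).over K * !![0, 0, 0; 0, 0, 0; c, 0, 0]) *ᵥ x))})) ⟨?_, ?_⟩)
  · rintro ⟨u, t⟩ ⟨u', t'⟩ h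
    have h' := congrArg Subtype.val h
    have h0 := congrFun h' 0
    have h1 := congrFun h' 1
    simp only [Matrix.cons_val_zero, Matrix.cons_val_one] at h0 h1
    exact Prod.ext (Units.ext h0) h1
  · rintro ⟨x, hx0, hiso, hPx⟩
    rw [dotProduct_antidiagonal_three_mulVec] at hiso
    rw [dotProduct_cornerSymmetric_form] at hPx
    have hx00 : x 0 ≠ 0 := by
      intro h0
      rw [h0, zero_pow two_ne_zero, mul_zero] at hPx
      exact hP0 hPx
    have h2x : (2 : K) * x 0 ≠ 0 := mul_ne_zero h2 hx00
    refine ⟨(Units.mk0 (x 0) hx00, x 1), Subtype.ext ?_⟩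
    funext i
    fin_cases i
    · simp
    · simp
    · simp only [Units.val_mk0, Fin.reduceFinMk, Matrix.cons_val_two, Matrix.tail_cons, Matrix.head_cons]
      field_simp
      linear_combination (-1 : K) * hiso

end NormalForms

/-! ## §4 The cut counts in the normalised parameters, for any `Y` in the two nilpotent orbits -/

section Params

variable [Finite K]

/-- **REGULAR NILPOTENT: `#{p : P(ᵗx̄_p(J₀Y)x̄_p)} = #{t ∈ K : P t}`** for a `J₀`-symmetric `Y` with `Y³ = 0 ≠ Y²` (`2 ≠ 0`) and any square-class-invariant `P` with `¬P 0` —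
«on the conic minus its two `Q_Y`-null points, `Q_Y` meets every square class as often as the class has elements»: transport to `R` (★ `exists_orthogonal_conj_eq_regularSymmetric`,
§1), count there (§3), divide by `q − 1` (§2). [cite: Wilson2009, §3.7.1 p. 70] [cite: CollingwoodMcGovern1993, §9.3] [cite: BruhatTits1972, §10] -/
theorem natCard_params_eq_natCard_of_sq_ne_zero (h2 : (2 : K) ≠ 0) {Y : Matrix (Fin 3) (Fin 3) K}
    (hYs : ((StdForm.antidiagonal 3).over K)⁻¹ * (Y.map (RingHom.id K))ᵀ * (StdForm.antidiagonal 3).over K = Y) (h3 : Y ^ 3 = 0) (hsq : Y * Y ≠ 0)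
    (P : K → Prop) (hP : ∀ c t : K, c ≠ 0 → (P (c * c * t) ↔ P t)) (hP0 : ¬ P 0) :
    Nat.card {p : Option {p : K × K // p.2 + (RingHom.id K) p.2 + p.1 * (RingHom.id K) p.1 = 0} //
        P ((p.elim (Pi.single 2 1) fun q => ![(1 : K), q.1.1, q.1.2]) ⬝ᵥ ((((StdForm.antidiagonal 3).over K) * Y) *ᵥ (p.elim (Pi.single 2 1) fun q => ![(1 : K), q.1.1, q.1.2])))} =
      Nat.card {t : K // P t} := by
  classical
  haveI := Fintype.ofFinite K
  obtain ⟨g, hg, hY⟩ := exists_orthogonal_conj_eq_regularSymmetric h2 hYs h3 hsq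
  have h := card_sub_one_mul_natCard_params_eq_ncard Y P hP
  rw [← ncard_isotropic_form_conj_eq_of_pred hg Y P, hY, ncard_isotropic_regularSymmetric_form_pred h2 P hP0] at h
  have hq : 0 < Nat.card K - 1 := by rw [Nat.card_eq_fintype_card]; exact Nat.sub_pos_of_lt Fintype.one_lt_card
  exact Nat.eq_of_mul_eq_mul_left hq h

/-- **RANK ONE, CLASS MET: `#{p : P(ᵗx̄_p(J₀Y)x̄_p)} = q`** when `gYg⁻¹ = N(c)` (`g ∈ O(J₀)`) and `P c` (`P` square-class invariant, `¬P 0`, `2 ≠ 0`): all `q` non-null points carry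
the class of `c`. [cite: Wilson2009, §3.7.1 p. 70] [cite: CollingwoodMcGovern1993, §9.3] [cite: BruhatTits1972, §10] -/
theorem natCard_params_eq_card_of_conj_cornerSymmetric (h2 : (2 : K) ≠ 0) {g : GL (Fin 3) K}
    (hg : g ∈ unitaryGroupOfForm (RingHom.id K) ((StdForm.antidiagonal 3).over K)) {c : K} {Y : Matrix (Fin 3) (Fin 3) K}
    (hY : (g : Matrix (Fin 3) (Fin 3) K) * Y * ((g⁻¹ : GL (Fin 3) K) : Matrix (Fin 3) (Fin 3) K) = !![0, 0, 0; 0, 0, 0; c, 0, 0])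
    (P : K → Prop) (hP : ∀ a t : K, a ≠ 0 → (P (a * a * t) ↔ P t)) (hP0 : ¬ P 0) (hPc : P c) :
    Nat.card {p : Option {p : K × K // p.2 + (RingHom.id K) p.2 + p.1 * (RingHom.id K) p.1 = 0} //
        P ((p.elim (Pi.single 2 1) fun q => ![(1 : K), q.1.1, q.1.2]) ⬝ᵥ ((((StdForm.antidiagonal 3).over K) * Y) *ᵥ (p.elim (Pi.single 2 1) fun q => ![(1 : K), q.1.1, q.1.2])))} =
      Nat.card K := by
  classical
  haveI := Fintype.ofFinite K
  have h := card_sub_one_mul_natCard_params_eq_ncard Y P hP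
  rw [← ncard_isotropic_form_conj_eq_of_pred hg Y P, hY, ncard_isotropic_cornerSymmetric_form_pred_of_pos h2 c P hP hP0 hPc] at h
  have hq : 0 < Nat.card K - 1 := by rw [Nat.card_eq_fintype_card]; exact Nat.sub_pos_of_lt Fintype.one_lt_card
  exact Nat.eq_of_mul_eq_mul_left hq h

omit [Finite K] in
/-- **RANK ONE, THE CLASS IS CONSTANT OFF THE NULL POINT**: if `gYg⁻¹ = N(c)` (`g ∈ O(J₀)`), then for EVERY vector `x` with `ᵗx(J₀Y)x ≠ 0` and every square-class-invariant `P`,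
`P(ᵗx(J₀Y)x) ↔ P(c)` — indeed `ᵗx(J₀Y)x = c·(gx)₁²`. [cite: CollingwoodMcGovern1993, §9.3] [cite: Wilson2009, §3.7.1 p. 70] -/
theorem pred_form_iff_of_conj_cornerSymmetric {g : GL (Fin 3) K} (hg : g ∈ unitaryGroupOfForm (RingHom.id K) ((StdForm.antidiagonal 3).over K))
    {c : K} {Y : Matrix (Fin 3) (Fin 3) K}
    (hY : (g : Matrix (Fin 3) (Fin 3) K) * Y * ((g⁻¹ : GL (Fin 3) K) : Matrix (Fin 3) (Fin 3) K) = !![0, 0, 0; 0, 0, 0; c, 0, 0])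
    (P : K → Prop) (hP : ∀ a t : K, a ≠ 0 → (P (a * a * t) ↔ P t)) {x : Fin 3 → K} (hx : x ⬝ᵥ ((((StdForm.antidiagonal 3).over K) * Y) *ᵥ x) ≠ 0) :
    P (x ⬝ᵥ ((((StdForm.antidiagonal 3).over K) * Y) *ᵥ x)) ↔ P c := by
  have hYe : Y = ((g⁻¹ : GL (Fin 3) K) : Matrix (Fin 3) (Fin 3) K) * !![0, 0, 0; 0, 0, 0; c, 0, 0] * (g : Matrix (Fin 3) (Fin 3) K) := by
    rw [← hY, coe_inv_mul_conj_mul_coe]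
  have hval : x ⬝ᵥ ((((StdForm.antidiagonal 3).over K) * Y) *ᵥ x) = c * (((g : Matrix (Fin 3) (Fin 3) K) *ᵥ x) 0) ^ 2 := by
    rw [hYe, dotProduct_mulVec_conj_of_mem hg, dotProduct_cornerSymmetric_form]
  rw [hval] at hx ⊢
  have hg0 : ((g : Matrix (Fin 3) (Fin 3) K) *ᵥ x) 0 ≠ 0 := fun h0 => hx (by rw [h0, zero_pow two_ne_zero, mul_zero])
  rw [show c * (((g : Matrix (Fin 3) (Fin 3) K) *ᵥ x) 0) ^ 2 = ((g : Matrix (Fin 3) (Fin 3) K) *ᵥ x) 0 * ((g : Matrix (Fin 3) (Fin 3) K) *ᵥ x) 0 * c by ring]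
  exact hP _ _ hg0

omit [Finite K] in
/-- **RANK ONE, CLASS MISSED: `#{p : P(ᵗx̄_p(J₀Y)x̄_p)} = 0`** when `gYg⁻¹ = N(c)` and `¬P c` (`P` square-class invariant, `¬P 0`): no point carries a class other than `c`'s.
[cite: Wilson2009, §3.7.1 p. 70] [cite: CollingwoodMcGovern1993, §9.3] -/
theorem natCard_params_eq_zero_of_conj_cornerSymmetric {g : GL (Fin 3) K}
    (hg : g ∈ unitaryGroupOfForm (RingHom.id K) ((StdForm.antidiagonal 3).over K)) {c : K} {Y : Matrix (Fin 3) (Fin 3) K}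
    (hY : (g : Matrix (Fin 3) (Fin 3) K) * Y * ((g⁻¹ : GL (Fin 3) K) : Matrix (Fin 3) (Fin 3) K) = !![0, 0, 0; 0, 0, 0; c, 0, 0])
    (P : K → Prop) (hP : ∀ a t : K, a ≠ 0 → (P (a * a * t) ↔ P t)) (hP0 : ¬ P 0) (hPc : ¬ P c) :
    Nat.card {p : Option {p : K × K // p.2 + (RingHom.id K) p.2 + p.1 * (RingHom.id K) p.1 = 0} //
        P ((p.elim (Pi.single 2 1) fun q => ![(1 : K), q.1.1, q.1.2]) ⬝ᵥ ((((StdForm.antidiagonal 3).over K) * Y) *ᵥ (p.elim (Pi.single 2 1) fun q => ![(1 : K), q.1.1, q.1.2])))} = 0 := by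
  rw [Nat.card_eq_zero]
  left
  refine ⟨fun ⟨p, hp⟩ => ?_⟩
  by_cases hx : (p.elim (Pi.single 2 1) fun q => ![(1 : K), q.1.1, q.1.2]) ⬝ᵥ ((((StdForm.antidiagonal 3).over K) * Y) *ᵥ (p.elim (Pi.single 2 1) fun q => ![(1 : K), q.1.1, q.1.2])) = 0
  · rw [hx] at hp; exact hP0 hp
  · exact hPc ((pred_form_iff_of_conj_cornerSymmetric hg hY P hP hx).1 hp)

end Params

/-! ## §5 The class split: `χ`-classes and token classes -/

section Classes

variable [Fintype K] [DecidableEq K]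

/-- **`2·#{t ∈ K : χ(c₀·t) = σ} = q − 1`** for `σ = ±1`, `c₀ ≠ 0`, odd `q`: there are as many non-zero squares as non-squares (`Σ_t χ(t) = 0`, ★ `quadraticChar_sum_zero`, and `χ² = 1` off `0`).
[cite: IrelandRosen1990, Ch. 8 §1] -/
theorem two_mul_natCard_quadraticChar_mul_eq (hK : ringChar K ≠ 2) {c₀ : K} (hc₀ : c₀ ≠ 0) {σ : ℤ} (hσ : σ = 1 ∨ σ = -1) :
    2 * Nat.card {t : K // quadraticChar K (c₀ * t) = σ} = Nat.card K - 1 := by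
  -- reduce to `c₀ = 1` along `t ↦ c₀·t`
  have hred : Nat.card {t : K // quadraticChar K (c₀ * t) = σ} = Nat.card {t : K // quadraticChar K t = σ} :=
    Nat.card_congr (Equiv.subtypeEquiv (Equiv.mulLeft₀ c₀ hc₀) fun t => by simp)
  rw [hred, Nat.card_eq_fintype_card, Fintype.card_subtype, Nat.card_eq_fintype_card]
  -- `2·[χ t = σ] = χ(t)² + σ·χ(t)` pointwise, summed: `(q − 1) + σ·0`
  have hσ0 : (0 : ℤ) ≠ σ := by rcases hσ with rfl | rfl <;> decide
  have hpt : ∀ t : K, (2 : ℤ) * (if quadraticChar K t = σ then 1 else 0) = quadraticChar K t ^ 2 + σ * quadraticChar K t := by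
    intro t
    rcases eq_or_ne t 0 with rfl | ht
    · rw [quadraticChar_zero, if_neg hσ0]; ring
    · rcases quadraticChar_dichotomy ht with h | h <;> rcases hσ with rfl | rfl <;> rw [h] <;> norm_num
  have hsq : ∀ t : K, quadraticChar K t ^ 2 = 1 - if t = 0 then 1 else 0 := by
    intro t
    rcases eq_or_ne t 0 with rfl | ht
    · rw [quadraticChar_zero, if_pos rfl]; ring
    · rw [quadraticChar_sq_one ht, if_neg ht]; ring
  have hsum : (2 : ℤ) * ((Finset.univ.filter fun t : K => quadraticChar K t = σ).card : ℤ) = (Fintype.card K : ℤ) - 1 := by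
    rw [Finset.natCast_card_filter, Finset.mul_sum]
    simp_rw [hpt, Finset.sum_add_distrib, ← Finset.mul_sum, quadraticChar_sum_zero hK, mul_zero, add_zero, hsq, Finset.sum_sub_distrib,
      Finset.sum_const, Finset.card_univ, Finset.sum_ite_eq' Finset.univ (0 : K), Finset.mem_univ, if_true]
    simp
  have h1 : 1 ≤ Fintype.card K := Fintype.card_pos
  zify [h1]
  exact hsum

/-- **THE CLASS SPLIT, regular nilpotent: `2·#{p : χ(c₀·ᵗx̄_p(J₀Y)x̄_p) = σ} = q − 1`** for `Y³ = 0 ≠ Y²` `J₀`-symmetric, `c₀ ≠ 0`, `σ = ±1`, odd `q` — the `q − 1` non-null points of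
the conic are shared equally by the two classes. [cite: Wilson2009, §3.7.1 p. 70] [cite: IrelandRosen1990, Ch. 8 §1] [cite: BruhatTits1972, §10] -/
theorem two_mul_natCard_params_quadraticChar_eq_of_sq_ne_zero (hK : ringChar K ≠ 2) {Y : Matrix (Fin 3) (Fin 3) K}
    (hYs : ((StdForm.antidiagonal 3).over K)⁻¹ * (Y.map (RingHom.id K))ᵀ * (StdForm.antidiagonal 3).over K = Y) (h3 : Y ^ 3 = 0) (hsq : Y * Y ≠ 0)
    {c₀ : K} (hc₀ : c₀ ≠ 0) {σ : ℤ} (hσ : σ = 1 ∨ σ = -1) :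
    2 * Nat.card {p : Option {p : K × K // p.2 + (RingHom.id K) p.2 + p.1 * (RingHom.id K) p.1 = 0} //
        quadraticChar K (c₀ * ((p.elim (Pi.single 2 1) fun q => ![(1 : K), q.1.1, q.1.2]) ⬝ᵥ ((((StdForm.antidiagonal 3).over K) * Y) *ᵥ (p.elim (Pi.single 2 1) fun q => ![(1 : K), q.1.1, q.1.2])))) = σ} =
      Nat.card K - 1 := by
  have hσ0 : (0 : ℤ) ≠ σ := by rcases hσ with rfl | rfl <;> decide
  have h := natCard_params_eq_natCard_of_sq_ne_zero (Ring.two_ne_zero hK) hYs h3 hsq (fun t => quadraticChar K (c₀ * t) = σ)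
    (fun c t hc => by rw [show c₀ * (c * c * t) = c ^ 2 * (c₀ * t) by ring, map_mul, quadraticChar_sq_one' hc, one_mul])
    (by rw [mul_zero, quadraticChar_zero]; exact hσ0)
  rw [h]
  exact two_mul_natCard_quadraticChar_mul_eq hK hc₀ hσ

/-- **THE ENGINE'S `hO` TOKEN: `q·#{p : χ(c₀·ᵗx̄_p(J₀Y)x̄_p) = σ} = q.choose 2`** (`= q(q−1)∕2`: the `q` lifts of each of the `(q−1)∕2` lines of class `σ`), `Y³ = 0 ≠ Y²`.
[cite: Wilson2009, §3.7.1 p. 70] [cite: IrelandRosen1990, Ch. 8 §1] [cite: BruhatTits1972, §10] -/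
theorem natCard_mul_natCard_params_quadraticChar_eq_choose_two (hK : ringChar K ≠ 2) {Y : Matrix (Fin 3) (Fin 3) K}
    (hYs : ((StdForm.antidiagonal 3).over K)⁻¹ * (Y.map (RingHom.id K))ᵀ * (StdForm.antidiagonal 3).over K = Y) (h3 : Y ^ 3 = 0) (hsq : Y * Y ≠ 0)
    {c₀ : K} (hc₀ : c₀ ≠ 0) {σ : ℤ} (hσ : σ = 1 ∨ σ = -1) :
    Nat.card K * Nat.card {p : Option {p : K × K // p.2 + (RingHom.id K) p.2 + p.1 * (RingHom.id K) p.1 = 0} //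
        quadraticChar K (c₀ * ((p.elim (Pi.single 2 1) fun q => ![(1 : K), q.1.1, q.1.2]) ⬝ᵥ ((((StdForm.antidiagonal 3).over K) * Y) *ᵥ (p.elim (Pi.single 2 1) fun q => ![(1 : K), q.1.1, q.1.2])))) = σ} =
      (Nat.card K).choose 2 := by
  have h := two_mul_natCard_params_quadraticChar_eq_of_sq_ne_zero hK hYs h3 hsq hc₀ hσ
  rw [Nat.choose_two_right, ← h, Nat.mul_left_comm, Nat.mul_div_cancel_left _ Nat.two_pos]

/-- **THE CLASS SPLIT IN TOKEN FORM: `2·#{p : ∃ a ≠ 0, ᵗx̄_p(J₀Y)x̄_p = s·a²} = q − 1`** for `Y³ = 0 ≠ Y²` `J₀`-symmetric, `s ≠ 0`, `2 ≠ 0` (the class `s·K×²` is `{χ(s·t) = 1}`).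
[cite: Wilson2009, §3.7.1 p. 70] [cite: IrelandRosen1990, Ch. 8 §1] [cite: BruhatTits1972, §10] -/
theorem two_mul_natCard_params_sqClass_eq_of_sq_ne_zero (hK : ringChar K ≠ 2) {Y : Matrix (Fin 3) (Fin 3) K}
    (hYs : ((StdForm.antidiagonal 3).over K)⁻¹ * (Y.map (RingHom.id K))ᵀ * (StdForm.antidiagonal 3).over K = Y) (h3 : Y ^ 3 = 0) (hsq : Y * Y ≠ 0)
    {s : K} (hs : s ≠ 0) :
    2 * Nat.card {p : Option {p : K × K // p.2 + (RingHom.id K) p.2 + p.1 * (RingHom.id K) p.1 = 0} //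
        ∃ a : K, a ≠ 0 ∧ (p.elim (Pi.single 2 1) fun q => ![(1 : K), q.1.1, q.1.2]) ⬝ᵥ ((((StdForm.antidiagonal 3).over K) * Y) *ᵥ (p.elim (Pi.single 2 1) fun q => ![(1 : K), q.1.1, q.1.2])) = s * a ^ 2} =
      Nat.card K - 1 := by
  -- the token class `∃ a ≠ 0, t = s·a²` is the `χ`-class `χ(s·t) = 1`
  have hiff : ∀ t : K, (∃ a : K, a ≠ 0 ∧ t = s * a ^ 2) ↔ quadraticChar K (s * t) = 1 := by
    intro t
    constructor
    · rintro ⟨a, ha, rfl⟩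
      rw [show s * (s * a ^ 2) = (s * a) ^ 2 by ring]
      exact quadraticChar_sq_one' (mul_ne_zero hs ha)
    · intro h
      have hst : s * t ≠ 0 := fun h0 => by rw [h0, quadraticChar_zero] at h; exact zero_ne_one h
      obtain ⟨b, hb⟩ := (quadraticChar_one_iff_isSquare hst).1 h
      have hb0 : b ≠ 0 := fun hb0 => hst (by rw [hb, hb0, mul_zero])
      refine ⟨b / s, div_ne_zero hb0 hs, ?_⟩
      field_simp
      linear_combination hb
  have h := natCard_params_eq_natCard_of_sq_ne_zero (Ring.two_ne_zero hK) hYs h3 hsq (fun t => ∃ a : K, a ≠ 0 ∧ t = s * a ^ 2)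
    (fun c t hc => by
      simp only [hiff]
      rw [show s * (c * c * t) = c ^ 2 * (s * t) by ring, map_mul, quadraticChar_sq_one' hc, one_mul])
    (by simp only [hiff, mul_zero, quadraticChar_zero]; exact zero_ne_one)
  rw [h, Nat.card_congr (Equiv.subtypeEquivRight hiff)]
  exact two_mul_natCard_quadraticChar_mul_eq hK hs (Or.inl rfl)

/-- **THE CLASS COUNT, rank one: `#{p : χ(c₀·ᵗx̄_p(J₀Y)x̄_p) = σ} = q` if `χ(c₀c) = σ`, else `0`**, for `gYg⁻¹ = N(c)` (`g ∈ O(J₀)`, `σ = ±1`; any `c, c₀` — for `c₀c = 0` both sides vanish) — the engine's `hP`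
row: the `q` non-null points all carry the class of `c`. [cite: Wilson2009, §3.7.1 p. 70] [cite: CollingwoodMcGovern1993, §9.3] [cite: BruhatTits1972, §10] -/
theorem natCard_params_quadraticChar_eq_ite_of_conj_cornerSymmetric (hK : ringChar K ≠ 2) {g : GL (Fin 3) K}
    (hg : g ∈ unitaryGroupOfForm (RingHom.id K) ((StdForm.antidiagonal 3).over K)) {c : K} {Y : Matrix (Fin 3) (Fin 3) K}
    (hY : (g : Matrix (Fin 3) (Fin 3) K) * Y * ((g⁻¹ : GL (Fin 3) K) : Matrix (Fin 3) (Fin 3) K) = !![0, 0, 0; 0, 0, 0; c, 0, 0])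
    (c₀ : K) {σ : ℤ} (hσ : σ = 1 ∨ σ = -1) :
    Nat.card {p : Option {p : K × K // p.2 + (RingHom.id K) p.2 + p.1 * (RingHom.id K) p.1 = 0} //
        quadraticChar K (c₀ * ((p.elim (Pi.single 2 1) fun q => ![(1 : K), q.1.1, q.1.2]) ⬝ᵥ ((((StdForm.antidiagonal 3).over K) * Y) *ᵥ (p.elim (Pi.single 2 1) fun q => ![(1 : K), q.1.1, q.1.2])))) = σ} =
      if quadraticChar K (c₀ * c) = σ then Nat.card K else 0 := by
  have hσ0 : (0 : ℤ) ≠ σ := by rcases hσ with rfl | rfl <;> decide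
  have hP : ∀ a t : K, a ≠ 0 → (quadraticChar K (c₀ * (a * a * t)) = σ ↔ quadraticChar K (c₀ * t) = σ) := fun a t ha => by
    rw [show c₀ * (a * a * t) = a ^ 2 * (c₀ * t) by ring, map_mul, quadraticChar_sq_one' ha, one_mul]
  have hP0 : ¬ quadraticChar K (c₀ * 0) = σ := by rw [mul_zero, quadraticChar_zero]; exact hσ0
  split_ifs with hcls
  · exact natCard_params_eq_card_of_conj_cornerSymmetric (Ring.two_ne_zero hK) hg hY (fun t => quadraticChar K (c₀ * t) = σ) hP hP0 hcls
  · exact natCard_params_eq_zero_of_conj_cornerSymmetric hg hY (fun t => quadraticChar K (c₀ * t) = σ) hP hP0 hcls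

end Classes

end Literature.GroupTheory.SpecificGroups
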